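import Literature.Probability.FitznerVanDerHofstad2017.NobleBoundsNCover
import Literature.Probability.FitznerVanDerHofstad2017.NobleBlocksAvgPerc
import Literature.Probability.FitznerVanDerHofstad2017.NobleBlocksPointwise
import Literature.Probability.FitznerVanDerHofstad2017.BlockSummationStar
import HarnessLib

/-!
# [FvdH17] Prop. 5.5 (5.34) at every `N ≥ 2` over the extended class index `Fin 3 ⊕ Unit` — pointwise special
# families and the assembly from the percolation estimates

R. Fitzner and R. van der Hofstad, *Mean-field behavior for nearest-neighbor percolation in `d > 10`*,
Electron. J. Probab. **22** (2017) no. 43; arXiv:1506.07977v2 — §5.1 (5.4) and "Elements of the bounds"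
(pp. 48–49), Prop. 5.5 (5.34) (p. 53), §6.2.1 (6.48)–(6.49) and Lemma 6.1 (pp. 65–67): "In order to do this,
we combine the building blocks to construct the bounding diagrams … we use induction on `N`."

## What this module is

The companion of `NobleBoundsNAssembly` for chains WITH special junctions (the next level passing through the
adjoined vertex `u_{i−1}`; class `★ := Sum.inr ()` of `BlockSummationStar`):
* §A (generic `G ι K`): the POINTWISE extended middle family `starBpt Bpt Ecpt Eopt Eocpt` (internal pair
  `(t,z)` exposed, Kroneckers `𝟙{w' = u}` on the closed entries as in `starB`) with its block-summation
  hypothesis `starBpt_hBpt` (`Σ_{t,z} starBpt ≤ starB`); the pointwise SECTION families `secEcpt`, `secEopt`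
  (`𝟙{z = w} Bpt^{κ,a₂,a'}`), `secEocpt` summing exactly to `secEc`, `secEo`, `secEoc`, and `secStarBpt` with
  `secStarBpt_hBpt`; six-point translation invariance `IsTransInv₆` and its inheritance by the sections
  (`isTransInv_secEo`, `isTransInv₃_secEc`, `isTransInv₃_secEoc`, `isTransInv₃_secEA`);
* §B (bond percolation on `ℤ^d`, letters `𝐋 = Letters.perc d p`): `isTransInv₆_blockBFullpt`; the assembly
  `tsum_nobleXiT_le_star_of_cover` — **(5.34) at `N = n+1` over `Fin 3 ⊕ Unit`** from a finite cover `(E, C)` of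
  the bounding events with classes valued in `Fin 3 ⊕ Unit` (`h1`, `hC`) and the pointwise class estimates `h2`
  against `starS (blockPS 𝐋) · Π starBpt (blockBFullpt 𝐋) Ecpt Eopt Eocpt · starA (blockAbar' 𝐋) EA ·
  starS (blockPE 𝐋)`, for ARBITRARY special families (parameters with their summation and translation
  hypotheses); its SECTION instance `tsum_nobleXiT_le_secStar_of_cover` (`a₂ = 2` pinned entry class, `a₀ = 0`
  closed exit class, `EA = secEA (blockAbar' 𝐋) 2`); and the bordered-printed-matrix bound
  `tsum_nobleXiT_le_bordered_of_cover`: under the section estimates,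
  `Σ_x Ξ^{(n+1)}(x) ≤ (P⃗^S,0) · [[B, B_{·,0}],[B_{2,·}, B_{2,0}]]^n · [[Ā',0],[Ā'_{2,·},0]] · (P⃗^E,0)`
  (`BlockSummationStar.matB_starB_sec_le`, `matAbar_starA_sec_le`, `star_chain_mono`) — the size model "pinned
  ≤ row 2, closed ≤ column 0" as a kernel inequality, conditional only on the percolation estimates `h2`.

No percolation estimate is proved here; nothing is cited as a fact; ADDITIVE module.
-/

noncomputable section

open scoped BigOperators ENNReal Matrix

/-! ## §A. Pointwise extended families (generic) -/

namespace Literature.Probability.FitznerVanDerHofstad2017.BlockSummation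

variable {G ι K : Type*}

/-- The POINTWISE extended middle family over `ι ⊕ Unit` (internal pair `(t,z)` of the level exposed): `Bpt` on
regular/regular, `𝟙{w' = u} Ecpt^{κ,a}(u,w,t,z,u')` on regular/`★`, `Eopt^{κ,a'}` on `★`/regular,
`𝟙{w' = u} Eocpt^κ(u,w,t,z,u')` on `★`/`★`.
[cite: FitznerVanDerHofstad2017, §5.1 (5.4) (arXiv:1506.07977v2 p. 48); §6.2.1 (6.49) (p. 65)] -/
def starBpt [DecidableEq G] (Bpt : K → ι → ι → G → G → G → G → G → G → ℝ≥0∞)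
    (Ecpt : K → ι → G → G → G → G → G → ℝ≥0∞) (Eopt : K → ι → G → G → G → G → G → G → ℝ≥0∞)
    (Eocpt : K → G → G → G → G → G → ℝ≥0∞) :
    K → ι ⊕ Unit → ι ⊕ Unit → G → G → G → G → G → G → ℝ≥0∞
  | κ, Sum.inl a, Sum.inl a' => Bpt κ a a'
  | κ, Sum.inl a, Sum.inr _ => fun u w t z w' u' => if w' = u then Ecpt κ a u w t z u' else 0
  | κ, Sum.inr _, Sum.inl a' => Eopt κ a'
  | κ, Sum.inr _, Sum.inr _ => fun u w t z w' u' => if w' = u then Eocpt κ u w t z u' else 0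

section StarBpt

variable [DecidableEq G] (Bpt : K → ι → ι → G → G → G → G → G → G → ℝ≥0∞)
  (Ecpt : K → ι → G → G → G → G → G → ℝ≥0∞) (Eopt : K → ι → G → G → G → G → G → G → ℝ≥0∞)
  (Eocpt : K → G → G → G → G → G → ℝ≥0∞)

/-- [folklore] -/
@[simp] theorem starBpt_inl_inl (κ : K) (a a' : ι) : starBpt Bpt Ecpt Eopt Eocpt κ (Sum.inl a) (Sum.inl a') = Bpt κ a a' :=
  rfl

/-- [folklore] -/
@[simp] theorem starBpt_inl_inr (κ : K) (a : ι) (s : Unit) (u w t z w' u' : G) :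
    starBpt Bpt Ecpt Eopt Eocpt κ (Sum.inl a) (Sum.inr s) u w t z w' u' =
      if w' = u then Ecpt κ a u w t z u' else 0 := rfl

/-- [folklore] -/
@[simp] theorem starBpt_inr_inl (κ : K) (s : Unit) (a' : ι) :
    starBpt Bpt Ecpt Eopt Eocpt κ (Sum.inr s) (Sum.inl a') = Eopt κ a' := rfl

/-- [folklore] -/
@[simp] theorem starBpt_inr_inr (κ : K) (s s' : Unit) (u w t z w' u' : G) :
    starBpt Bpt Ecpt Eopt Eocpt κ (Sum.inr s) (Sum.inr s') u w t z w' u' =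
      if w' = u then Eocpt κ u w t z u' else 0 := rfl

/-- **Block summation of the pointwise extended family**: if each pointwise special family sums (over its
internal pair) to at most the corresponding special family, then `Σ_{t,z} starBpt ≤ starB` — the `hBpt`
hypothesis of `le_recP_chain_of_cover` over `ι ⊕ Unit`. [folklore] -/
theorem starBpt_hBpt {B : K → ι → ι → G → G → G → G → ℝ≥0∞} {Ec : K → ι → G → G → G → ℝ≥0∞}
    {Eo : K → ι → G → G → G → G → ℝ≥0∞} {Eoc : K → G → G → G → ℝ≥0∞}
    (hBpt : ∀ κ a a' u w w' u', ∑' t, ∑' z, Bpt κ a a' u w t z w' u' ≤ B κ a a' u w w' u')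
    (hEc : ∀ κ a u w u', ∑' t, ∑' z, Ecpt κ a u w t z u' ≤ Ec κ a u w u')
    (hEo : ∀ κ a' u w w' u', ∑' t, ∑' z, Eopt κ a' u w t z w' u' ≤ Eo κ a' u w w' u')
    (hEoc : ∀ κ u w u', ∑' t, ∑' z, Eocpt κ u w t z u' ≤ Eoc κ u w u') :
    ∀ κ x y (u w w' u' : G), ∑' t, ∑' z, starBpt Bpt Ecpt Eopt Eocpt κ x y u w t z w' u' ≤
      starB B Ec Eo Eoc κ x y u w w' u'
  | κ, Sum.inl a, Sum.inl a', u, w, w', u' => hBpt κ a a' u w w' u'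
  | κ, Sum.inl a, Sum.inr _, u, w, w', u' => by
      by_cases h : w' = u <;> simp [h, hEc]
  | κ, Sum.inr _, Sum.inl a', u, w, w', u' => hEo κ a' u w w' u'
  | κ, Sum.inr _, Sum.inr _, u, w, w', u' => by
      by_cases h : w' = u <;> simp [h, hEoc]

end StarBpt

/-! ### The pointwise section families -/

/-- Pointwise closed section: `Ecpt^{κ,a}(u,w,t,z,u') := Bpt^{κ,a,a₀}(u,w,t,z,u',u')`.
[cite: FitznerVanDerHofstad2017, §5.1 (5.4) (arXiv:1506.07977v2 p. 48)] -/
def secEcpt (Bpt : K → ι → ι → G → G → G → G → G → G → ℝ≥0∞) (a₀ : ι) : K → ι → G → G → G → G → G → ℝ≥0∞ :=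
  fun κ a u w t z u' => Bpt κ a a₀ u w t z u' u'

/-- Pointwise pinned section: `Eopt^{κ,a'}(u,w,t,z,w',u') := 𝟙{z = w} Bpt^{κ,a₂,a'}(u,w,t,z,w',u')`.
[cite: FitznerVanDerHofstad2017, §5.1 (5.4) (arXiv:1506.07977v2 p. 48)] -/
def secEopt [DecidableEq G] (Bpt : K → ι → ι → G → G → G → G → G → G → ℝ≥0∞) (a₂ : ι) :
    K → ι → G → G → G → G → G → G → ℝ≥0∞ :=
  fun κ a' u w t z w' u' => if z = w then Bpt κ a₂ a' u w t z w' u' else 0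

/-- Pointwise pinned-and-closed section: `Eocpt^κ(u,w,t,z,u') := 𝟙{z = w} Bpt^{κ,a₂,a₀}(u,w,t,z,u',u')`.
[cite: FitznerVanDerHofstad2017, §5.1 (5.4) (arXiv:1506.07977v2 p. 48)] -/
def secEocpt [DecidableEq G] (Bpt : K → ι → ι → G → G → G → G → G → G → ℝ≥0∞) (a₂ a₀ : ι) :
    K → G → G → G → G → G → ℝ≥0∞ :=
  fun κ u w t z u' => if z = w then Bpt κ a₂ a₀ u w t z u' u' else 0

/-- The pointwise extended family under the SECTION choice. [folklore] -/
def secStarBpt [DecidableEq G] (Bpt : K → ι → ι → G → G → G → G → G → G → ℝ≥0∞) (a₂ a₀ : ι) :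
    K → ι ⊕ Unit → ι ⊕ Unit → G → G → G → G → G → G → ℝ≥0∞ :=
  starBpt Bpt (secEcpt Bpt a₀) (secEopt Bpt a₂) (secEocpt Bpt a₂ a₀)

/-- [folklore] -/
theorem tsum_tsum_secEcpt (Bpt : K → ι → ι → G → G → G → G → G → G → ℝ≥0∞) (a₀ : ι) (κ : K) (a : ι) (u w u' : G) :
    ∑' t, ∑' z, secEcpt Bpt a₀ κ a u w t z u' = secEc Bpt a₀ κ a u w u' := rfl

section Sections

variable [DecidableEq G] (Bpt : K → ι → ι → G → G → G → G → G → G → ℝ≥0∞)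

/-- [folklore] -/
theorem tsum_tsum_secEopt (a₂ : ι) (κ : K) (a' : ι) (u w w' u' : G) :
    ∑' t, ∑' z, secEopt Bpt a₂ κ a' u w t z w' u' = secEo Bpt a₂ κ a' u w w' u' :=
  tsum_congr fun t => tsum_ite_eq_zero_left (fun z => Bpt κ a₂ a' u w t z w' u') w

/-- [folklore] -/
theorem tsum_tsum_secEocpt (a₂ a₀ : ι) (κ : K) (u w u' : G) :
    ∑' t, ∑' z, secEocpt Bpt a₂ a₀ κ u w t z u' = secEoc Bpt a₂ a₀ κ u w u' :=
  tsum_congr fun t => tsum_ite_eq_zero_left (fun z => Bpt κ a₂ a₀ u w t z u' u') w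

/-- `Σ_{t,z} secStarBpt ≤ starB B (secEc …) (secEo …) (secEoc …)` given `Σ_{t,z} Bpt ≤ B`. [folklore] -/
theorem secStarBpt_hBpt {B : K → ι → ι → G → G → G → G → ℝ≥0∞}
    (hBpt : ∀ κ a a' u w w' u', ∑' t, ∑' z, Bpt κ a a' u w t z w' u' ≤ B κ a a' u w w' u') (a₂ a₀ : ι) :
    ∀ κ x y (u w w' u' : G), ∑' t, ∑' z, secStarBpt Bpt a₂ a₀ κ x y u w t z w' u' ≤
      starB B (secEc Bpt a₀) (secEo Bpt a₂) (secEoc Bpt a₂ a₀) κ x y u w w' u' :=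
  starBpt_hBpt Bpt _ _ _ hBpt (fun κ a u w u' => (tsum_tsum_secEcpt Bpt a₀ κ a u w u').le)
    (fun κ a' u w w' u' => (tsum_tsum_secEopt Bpt a₂ κ a' u w w' u').le)
    fun κ u w u' => (tsum_tsum_secEocpt Bpt a₂ a₀ κ u w u').le

end Sections

/-! ### Six-point translation invariance and its inheritance by the sections -/

section TransInv

variable [AddCommGroup G]

/-- Translation invariance of a six-point kernel. [folklore] -/
def IsTransInv₆ (M : G → G → G → G → G → G → ℝ≥0∞) : Prop :=
  ∀ g u w t z x y, M (u + g) (w + g) (t + g) (z + g) (x + g) (y + g) = M u w t z x y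

/-- [folklore] -/
theorem isTransInv_secEo {Bpt : K → ι → ι → G → G → G → G → G → G → ℝ≥0∞} (hBpt : ∀ κ a a', IsTransInv₆ (Bpt κ a a'))
    (a₂ : ι) (κ : K) (a' : ι) : IsTransInv (secEo Bpt a₂ κ a') := fun g u w w' u' => by
  simp only [secEo]
  rw [← tsum_add_right_eq (fun t => Bpt κ a₂ a' (u + g) (w + g) t (w + g) (w' + g) (u' + g)) g]
  exact tsum_congr fun t => hBpt κ a₂ a' g u w t w w' u'

/-- [folklore] -/
theorem isTransInv₃_secEc {Bpt : K → ι → ι → G → G → G → G → G → G → ℝ≥0∞} (hBpt : ∀ κ a a', IsTransInv₆ (Bpt κ a a'))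
    (a₀ : ι) (κ : K) (a : ι) : IsTransInv₃ (secEc Bpt a₀ κ a) := fun g u w u' => by
  simp only [secEc]
  rw [← tsum_add_right_eq (fun t => ∑' z, Bpt κ a a₀ (u + g) (w + g) t z (u' + g) (u' + g)) g]
  refine tsum_congr fun t => ?_
  rw [← tsum_add_right_eq (fun z => Bpt κ a a₀ (u + g) (w + g) (t + g) z (u' + g) (u' + g)) g]
  exact tsum_congr fun z => hBpt κ a a₀ g u w t z u' u'

/-- [folklore] -/
theorem isTransInv₃_secEoc {Bpt : K → ι → ι → G → G → G → G → G → G → ℝ≥0∞}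
    (hBpt : ∀ κ a a', IsTransInv₆ (Bpt κ a a')) (a₂ a₀ : ι) (κ : K) : IsTransInv₃ (secEoc Bpt a₂ a₀ κ) :=
  fun g u w u' => by
  simp only [secEoc]
  rw [← tsum_add_right_eq (fun t => Bpt κ a₂ a₀ (u + g) (w + g) t (w + g) (u' + g) (u' + g)) g]
  exact tsum_congr fun t => hBpt κ a₂ a₀ g u w t w u' u'

/-- [folklore] -/
theorem isTransInv₃_secEA {A : K → ι → ι → G → G → G → G → ℝ≥0∞} (hA : ∀ κ a c, IsTransInv (A κ a c)) (a₂ : ι)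
    (κ : K) (c : ι) : IsTransInv₃ (secEA A a₂ κ c) := fun g u w t => hA κ a₂ c g u w t w

end TransInv

end Literature.Probability.FitznerVanDerHofstad2017.BlockSummation

/-! ## §B. Bond percolation on `ℤ^d`: the assembly over `Fin 3 ⊕ Unit` -/

namespace Literature.Probability.FitznerVanDerHofstad2017

open _root_.MeasureTheory Literature.Probability.LatticeModels Literature.Probability.Percolation
open Literature.Probability.FitznerVanDerHofstad2017.NobleBlocks
open Literature.Probability.FitznerVanDerHofstad2017.BlockSummation
open Literature.Barriers.CriticalPhenomena

variable {d : ℕ}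

/-- The pointwise middle block `blockBFullpt 𝐋` is translation invariant in all six vertices. [folklore] -/
theorem isTransInv₆_blockBFullpt (L : Letters d) (κ : Fin d × Bool) (a a' : Fin 3) :
    IsTransInv₆ (blockBFullpt L κ a a') := fun g u w t z x y => by
  have hAst : ∀ c, blockAiotaSt L κ a c (u + g) (w + g) (t + g) (z + g) = blockAiotaSt L κ a c u w t z :=
    fun c => isTransInv_blockAiotaSt L κ a c g u w t z
  have hA : ∀ c, blockA L c a' (t + g) (z + g) (x + g) (y + g) = blockA L c a' t z x y :=
    fun c => isTransInv_blockA L c a' g t z x y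
  have hAi : blockAiota L κ a a' (u + g) (w + g) (x + g) (t + g) = blockAiota L κ a a' u w x t :=
    isTransInv_blockAiota L κ a a' g u w x t
  have hkd : kd (z + g) (t + g) = kd z t := by simp only [kd, add_left_inj]
  simp only [blockBFullpt, blockBpt, blockBNTpt, hAst, hA, hAi, hkd, add_sub_add_right_eq_sub]

section Perc

variable (p : unitInterval)

local notation "𝐋" => Letters.perc d p

/-- **Prop. 5.5 (5.34) at `N = n + 1` over the extended class index `Fin 3 ⊕ Unit`, FROM THE PERCOLATION
ESTIMATES, for arbitrary special families.**  Given special families `Ec Eo Eoc EA` with pointwise versions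
`Ecpt Eopt Eocpt` (`Σ_{t,z} ·pt ≤ ·`) and translation invariance, a finite cover `(E, C)` of the bounding events of
`Ξ^{(n+1)}(x)` with class tuples `a : Fin (n+1) → Fin 3 ⊕ Unit`, terminal class `c : Fin 3 ⊕ Unit` (`h1`, `hC`) and
the pointwise class estimates `h2` against `starS P^S · Π starBpt · starA Ā' · starS P^E`, the printed-norm bound
`Σ_x Ξ^{(n+1)}(x) ≤ (P⃗^S,0) · matB(starB B Ec Eo Eoc)^n · matAbar(starA Ā' EA) · (P⃗^E,0)` holds.
[cite: FitznerVanDerHofstad2017, Prop. 5.5 (5.34) (arXiv:1506.07977v2 p. 53); §5.1 (5.4), "Elements of the bounds" (pp. 48–49); Lemma 6.1 and §6.2.1 (pp. 65–67); §6.1 (6.4)–(6.5) (p. 58)] -/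
theorem tsum_nobleXiT_le_star_of_cover (n : ℕ)
    (Ec : Fin d × Bool → Fin 3 → Site d → Site d → Site d → ℝ≥0∞)
    (Eo : Fin d × Bool → Fin 3 → Site d → Site d → Site d → Site d → ℝ≥0∞)
    (Eoc : Fin d × Bool → Site d → Site d → Site d → ℝ≥0∞)
    (EA : Fin d × Bool → Fin 3 → Site d → Site d → Site d → ℝ≥0∞)
    (Ecpt : Fin d × Bool → Fin 3 → Site d → Site d → Site d → Site d → Site d → ℝ≥0∞)
    (Eopt : Fin d × Bool → Fin 3 → Site d → Site d → Site d → Site d → Site d → Site d → ℝ≥0∞)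
    (Eocpt : Fin d × Bool → Site d → Site d → Site d → Site d → Site d → ℝ≥0∞)
    (hEcpt : ∀ κ a u w u', ∑' t, ∑' z, Ecpt κ a u w t z u' ≤ Ec κ a u w u')
    (hEopt : ∀ κ a' u w w' u', ∑' t, ∑' z, Eopt κ a' u w t z w' u' ≤ Eo κ a' u w w' u')
    (hEocpt : ∀ κ u w u', ∑' t, ∑' z, Eocpt κ u w t z u' ≤ Eoc κ u w u')
    (hEc : ∀ κ a, IsTransInv₃ (Ec κ a)) (hEo : ∀ κ a', IsTransInv (Eo κ a')) (hEoc : ∀ κ, IsTransInv₃ (Eoc κ))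
    (hEA : ∀ κ c, IsTransInv₃ (EA κ c))
    (E : Site d → (Fin (n + 1) → Site d × Site d) → (Fin (n + 1) → Site d) → (Fin (n + 1) → Site d) →
      (Fin (n + 1) → Site d) → Set (Fin (n + 2) → BondConfig (Site d)))
    (C : Site d → (Fin (n + 1) → Site d × Site d) → (Fin (n + 1) → Site d) → (Fin (n + 1) → Site d) →
      (Fin (n + 1) → Site d) → (Fin (n + 1) → Fin 3 ⊕ Unit) → Fin 3 ⊕ Unit → Set (Fin (n + 2) → BondConfig (Site d)))
    (hC : ∀ x b w t z, E x b w t z ⊆ ⋃ a, ⋃ c, C x b w t z a c)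
    (h1 : ∀ x, nobleXiT d p (n + 1) x ≤ ∑' b : Fin (n + 1) → Site d × Site d, ∑' w : Fin (n + 1) → Site d,
      ∑' t : Fin (n + 1) → Site d, ∑' z : Fin (n + 1) → Site d,
        (∏ i, ENNReal.ofReal (bondJ d p ((b i).2 - (b i).1))) * piPerc d p (n + 2) (E x b w t z))
    (h2 : ∀ x (a : Fin (n + 1) → Fin 3 ⊕ Unit) (c : Fin 3 ⊕ Unit) (b : Fin (n + 1) → Site d × Site d)
      (w t z : Fin (n + 1) → Site d),
      (∏ i, ENNReal.ofReal (bondJ d p ((b i).2 - (b i).1))) * piPerc d p (n + 2) (E x b w t z ∩ C x b w t z a c) ≤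
        ∑ κ : Fin (n + 1) → Fin d × Bool, dirInd stepVec κ b *
          (starS (blockPS 𝐋) (a 0) (b 0).1 (w 0) *
            chainTail (starBpt (blockBFullpt 𝐋) Ecpt Eopt Eocpt) (starA (blockAbar' 𝐋) EA) (starS (blockPE 𝐋))
              x n κ a c b w t z)) :
    ∑' x, nobleXiT d p (n + 1) x ≤
      vecP (starS (blockPS 𝐋)) ᵥ* matB (starB (blockBFull 𝐋) Ec Eo Eoc) ^ n ᵥ* matAbar (starA (blockAbar' 𝐋) EA)
        ⬝ᵥ vecP (starS (blockPE 𝐋)) :=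
  tsum_le_vecMul_pow_dotProduct' (isTransInv_starB (isTransInv_blockBFull 𝐋) hEc hEo hEoc)
    (isTransInv_starA (isTransInv_blockAbar' 𝐋) hEA) (fun x => nobleXiT d p (n + 1) x) (starS (blockPS 𝐋))
    (starS (blockPE 𝐋)) n fun x =>
    nobleXiT_le_recP_chain_of_cover p x n (starS (blockPS 𝐋)) (starB (blockBFull 𝐋) Ec Eo Eoc)
      (starBpt (blockBFullpt 𝐋) Ecpt Eopt Eocpt) (starBpt_hBpt _ _ _ _ (blockBFullpt_hBpt 𝐋) hEcpt hEopt hEocpt)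
      (starA (blockAbar' 𝐋) EA) (starS (blockPE 𝐋)) (E x) (C x) (hC x) (h1 x) (h2 x)

/-- **(5.34) at `N = n + 1` over `Fin 3 ⊕ Unit` under the SECTION choice** (pinned special block = the `z = w`
section of `blockBFullpt 𝐋` with entry class `2`, closed = the exit-class-`0`, `w' = u'` section, pinned terminal
= the `z = w` section of the row `2` of `blockAbar' 𝐋`): from the cover and the pointwise class estimates against
`secStarBpt (blockBFullpt 𝐋) 2 0` and `starA (blockAbar' 𝐋) (secEA (blockAbar' 𝐋) 2)`.
[cite: FitznerVanDerHofstad2017, Prop. 5.5 (5.34) (arXiv:1506.07977v2 p. 53); §5.1 (5.4) (p. 48); Lemma 6.1 and §6.2.1 (pp. 65–67)] -/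
theorem tsum_nobleXiT_le_secStar_of_cover (n : ℕ)
    (E : Site d → (Fin (n + 1) → Site d × Site d) → (Fin (n + 1) → Site d) → (Fin (n + 1) → Site d) →
      (Fin (n + 1) → Site d) → Set (Fin (n + 2) → BondConfig (Site d)))
    (C : Site d → (Fin (n + 1) → Site d × Site d) → (Fin (n + 1) → Site d) → (Fin (n + 1) → Site d) →
      (Fin (n + 1) → Site d) → (Fin (n + 1) → Fin 3 ⊕ Unit) → Fin 3 ⊕ Unit → Set (Fin (n + 2) → BondConfig (Site d)))
    (hC : ∀ x b w t z, E x b w t z ⊆ ⋃ a, ⋃ c, C x b w t z a c)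
    (h1 : ∀ x, nobleXiT d p (n + 1) x ≤ ∑' b : Fin (n + 1) → Site d × Site d, ∑' w : Fin (n + 1) → Site d,
      ∑' t : Fin (n + 1) → Site d, ∑' z : Fin (n + 1) → Site d,
        (∏ i, ENNReal.ofReal (bondJ d p ((b i).2 - (b i).1))) * piPerc d p (n + 2) (E x b w t z))
    (h2 : ∀ x (a : Fin (n + 1) → Fin 3 ⊕ Unit) (c : Fin 3 ⊕ Unit) (b : Fin (n + 1) → Site d × Site d)
      (w t z : Fin (n + 1) → Site d),
      (∏ i, ENNReal.ofReal (bondJ d p ((b i).2 - (b i).1))) * piPerc d p (n + 2) (E x b w t z ∩ C x b w t z a c) ≤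
        ∑ κ : Fin (n + 1) → Fin d × Bool, dirInd stepVec κ b *
          (starS (blockPS 𝐋) (a 0) (b 0).1 (w 0) *
            chainTail (secStarBpt (blockBFullpt 𝐋) 2 0) (starA (blockAbar' 𝐋) (secEA (blockAbar' 𝐋) 2))
              (starS (blockPE 𝐋)) x n κ a c b w t z)) :
    ∑' x, nobleXiT d p (n + 1) x ≤
      vecP (starS (blockPS 𝐋)) ᵥ*
        matB (starB (blockBFull 𝐋) (secEc (blockBFullpt 𝐋) 0) (secEo (blockBFullpt 𝐋) 2) (secEoc (blockBFullpt 𝐋) 2 0)) ^ n ᵥ*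
          matAbar (starA (blockAbar' 𝐋) (secEA (blockAbar' 𝐋) 2)) ⬝ᵥ vecP (starS (blockPE 𝐋)) :=
  tsum_nobleXiT_le_star_of_cover p n _ _ _ _ (secEcpt (blockBFullpt 𝐋) 0) (secEopt (blockBFullpt 𝐋) 2)
    (secEocpt (blockBFullpt 𝐋) 2 0) (fun κ a u w u' => (tsum_tsum_secEcpt (blockBFullpt 𝐋) 0 κ a u w u').le)
    (fun κ a' u w w' u' => (tsum_tsum_secEopt (blockBFullpt 𝐋) 2 κ a' u w w' u').le)
    (fun κ u w u' => (tsum_tsum_secEocpt (blockBFullpt 𝐋) 2 0 κ u w u').le)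
    (isTransInv₃_secEc (isTransInv₆_blockBFullpt 𝐋) 0) (isTransInv_secEo (isTransInv₆_blockBFullpt 𝐋) 2)
    (isTransInv₃_secEoc (isTransInv₆_blockBFullpt 𝐋) 2 0) (isTransInv₃_secEA (isTransInv_blockAbar' 𝐋) 2)
    E C hC h1 h2

/-- **The size model as a kernel inequality**: under the section estimates, `Σ_x Ξ^{(n+1)}(x)` is bounded by the
PRINTED matrices bordered with their row `2` and column `0`:
`(P⃗^S,0) · [[B, B_{·,0}],[B_{2,·}, B_{2,0}]]^n · [[Ā',0],[Ā'_{2,·},0]] · (P⃗^E,0)` (`B = matB (blockBFull 𝐋)`,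
`Ā' = matAbar (blockAbar' 𝐋) = matAbarIota' 𝐋`).
[cite: FitznerVanDerHofstad2017, Prop. 5.5 (5.34) (arXiv:1506.07977v2 p. 53); §5.1 "Elements of the bounds" (p. 49); Lemma 6.1 and §6.2.1 (pp. 65–67)] -/
theorem tsum_nobleXiT_le_bordered_of_cover (n : ℕ)
    (E : Site d → (Fin (n + 1) → Site d × Site d) → (Fin (n + 1) → Site d) → (Fin (n + 1) → Site d) →
      (Fin (n + 1) → Site d) → Set (Fin (n + 2) → BondConfig (Site d)))
    (C : Site d → (Fin (n + 1) → Site d × Site d) → (Fin (n + 1) → Site d) → (Fin (n + 1) → Site d) →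
      (Fin (n + 1) → Site d) → (Fin (n + 1) → Fin 3 ⊕ Unit) → Fin 3 ⊕ Unit → Set (Fin (n + 2) → BondConfig (Site d)))
    (hC : ∀ x b w t z, E x b w t z ⊆ ⋃ a, ⋃ c, C x b w t z a c)
    (h1 : ∀ x, nobleXiT d p (n + 1) x ≤ ∑' b : Fin (n + 1) → Site d × Site d, ∑' w : Fin (n + 1) → Site d,
      ∑' t : Fin (n + 1) → Site d, ∑' z : Fin (n + 1) → Site d,
        (∏ i, ENNReal.ofReal (bondJ d p ((b i).2 - (b i).1))) * piPerc d p (n + 2) (E x b w t z))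
    (h2 : ∀ x (a : Fin (n + 1) → Fin 3 ⊕ Unit) (c : Fin 3 ⊕ Unit) (b : Fin (n + 1) → Site d × Site d)
      (w t z : Fin (n + 1) → Site d),
      (∏ i, ENNReal.ofReal (bondJ d p ((b i).2 - (b i).1))) * piPerc d p (n + 2) (E x b w t z ∩ C x b w t z a c) ≤
        ∑ κ : Fin (n + 1) → Fin d × Bool, dirInd stepVec κ b *
          (starS (blockPS 𝐋) (a 0) (b 0).1 (w 0) *
            chainTail (secStarBpt (blockBFullpt 𝐋) 2 0) (starA (blockAbar' 𝐋) (secEA (blockAbar' 𝐋) 2))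
              (starS (blockPE 𝐋)) x n κ a c b w t z)) :
    ∑' x, nobleXiT d p (n + 1) x ≤
      Sum.elim (vecPS 𝐋) (0 : Unit → ℝ≥0∞) ᵥ*
        Matrix.fromBlocks (matB (blockBFull 𝐋)) (Matrix.of fun (a : Fin 3) (_ : Unit) => matB (blockBFull 𝐋) a 0)
          (Matrix.of fun (_ : Unit) (a' : Fin 3) => matB (blockBFull 𝐋) 2 a')
          (Matrix.of fun (_ : Unit) (_ : Unit) => matB (blockBFull 𝐋) 2 0) ^ n ᵥ*
        Matrix.fromBlocks (matAbar (blockAbar' 𝐋)) (0 : Matrix (Fin 3) Unit ℝ≥0∞)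
          (Matrix.of fun (_ : Unit) (c : Fin 3) => matAbar (blockAbar' 𝐋) 2 c) (0 : Matrix Unit Unit ℝ≥0∞) ⬝ᵥ
          Sum.elim (vecPE 𝐋) (0 : Unit → ℝ≥0∞) := by
  refine (tsum_nobleXiT_le_secStar_of_cover p n E C hC h1 h2).trans ?_
  rw [vecP_starS, vecP_starS]
  exact star_chain_mono (fun i => le_rfl) (matB_starB_sec_le (blockBFullpt_hBpt 𝐋) 2 0)
    (matAbar_starA_sec_le (blockAbar' 𝐋) 2) (fun i => le_rfl) n

end Perc

end Literature.Probability.FitznerVanDerHofstad2017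

end
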